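import Summits.FinalStateConjecture.FinalStateConjecture.Theses.BartnikGapSettling
import Literature.Geometry.Lorentzian.TrivialDataAdmissible

/-!
# `GenericCensorshipCollarMargin` (stmt-FinalStateConjecture-10809) — negative side:
# junk collars kill the crux as typed

The collar-margin clause shared by the cruxes `GenericCensorshipCollarMargin` (conclusion) and
`GapExhaustion` (hypothesis) of route `BartnikGapSettling` quantifies over thick collar charts of
EVERY label `M₁ > 0` and measures closeness to boosted Kerr in the UNWEIGHTED componentwise `Cᵏ`
sup-norm `Spacetime.truncDeviationCk`. Because the Kerr–Schild form is homogeneous of degree `0`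
under `(M, a, x) ↦ (λM, λa, λx)`, the `m`-th derivative of the deviation of a rescaled chart
`x ↦ p + M₁ Ψ(x/M₁)` carries a factor `M₁^{-m}`, so for `M₁ → ∞` only `C⁰`-closeness of ONE
unit-scale spacelike embedding `Ψ` of the extremal (`a₁ = M₁`) Kerr–Schild collar slice into a
near-flat region is needed — and such embeddings exist by the Lorentzian one-sided Nash–Kuiper
theorem (A. Boukholkhal, arXiv:2407.19333v2, Thm. 1.2 / Prop. 3.1: every LONG spacelike embedding of
a compact Riemannian manifold into a Lorentzian manifold is `C⁰`-approximated by `C¹`-isometric,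
and by smooth `ε`-isometric, spacelike embeddings), the lapse/shift components being matched
exactly by the free transverse jet. Hence every spacetime with arbitrarily large near-flat regions
beyond each `J⁻(K)` — Minkowski space, and the far field of every admissible MGHD — carries late
thick collar charts of extremal label at every tolerance `(k₁, δ₁)`: the clause FAILS there.
Full argument: crux workfile `Cruxes/GenericCensorshipCollarMargin/MisstatedByMimicry.md`
(prover-line-stmt-FinalStateConjecture-10809-0, 2026-08-16).

This file isolates, as pure logic over the filed text, what that makes of the crux:

* `ExtremalJunkCollars` — the construction hypothesis (named `H` of the negative-modulo lane): every
  MGHD of every admissible datum carries, beyond every `J⁻(K₁)` and at every tolerance, an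
  extremal-label thick collar chart satisfying the clause's hypotheses verbatim. Expected TRUE by
  the argument above; not constructible in the tree today (convex integration; far-field Cauchy
  stability).
* `not_collarMarginClause_of_junk` — such a chart refutes the clause (`|M₁| ≤ χ₁ M₁ < M₁`).
* `GenericCensorshipCollarMargin_false_of_ExtremalJunkCollars` —
  `ExtremalJunkCollars → MGHDExists → ¬ GenericCensorshipCollarMargin`: under `H` and the route's
  own anti-vacuity support item `MGHDExists` (stmt-FinalStateConjecture-9937) the crux's property
  fails on the whole admissible class of the Minkowski slice, which is non-empty
  (`trivialData_mem_admissibleVacuumData`), so no admissible family leaves the exceptional set.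

Nothing here bears on weak cosmic censorship or the third law: the verdict is MISSTATED, with the
repair "window the label, `m₀ ≤ M₁ ≤ m₀⁻¹`" recorded in the workfile.

**Maintenance record (full-build repair, 2026-08-17).** Route `BartnikGapSettling` rev 3
(2026-08-16T23:15:51Z, after the summit re-type p126844) DROPPED its decl `GenericCensorshipCollarMargin`
(stmt-FinalStateConjecture-10809, closed) in favour of the tame-genericity successor
`TameCensorshipCollarMargin`, so the `open … (GenericCensorshipCollarMargin MGHDExists)` below and the
headline theorem stopped elaborating (the `MGHDExists` / `rcases` errors were a cascade; `MGHDExists`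
still exists). The dropped constant is re-declared below under its original fully-qualified name with
the item's ledger signature verbatim (a record `def`, neither a route item nor a literature fact; same
device as `CollisionIsometryCLTHsFreeEnergyConvexTransport.lean` / p132071), so that every theorem of
this append-only file keeps its name, statement and proof unchanged. Nothing here speaks about
`TameCensorshipCollarMargin`.
-/

noncomputable section

-- D-0017: single-problem summit, `Summit.<S>.<S>.…` by design (cf. lakefile `weak.linter.dupNamespace`).
set_option linter.dupNamespace false

open Set
open scoped Manifold ENNReal ContDiff Topology

namespace Summit.FinalStateConjecture.FinalStateConjecture.Theses.BartnikGapSettling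

/-- The crux `GenericCensorshipCollarMargin` (item stmt-FinalStateConjecture-10809) as route
`BartnikGapSettling` declared it until its rev 3 (2026-08-16T23:15:51Z), ledger signature verbatim:
Christodoulou-generically in the admissible vacuum data on `X`, every MGHD has complete future null
infinity AND satisfies the collar-margin clause (late thick collar charts `δ₁`-close in `C^{k₁}` to
boosted Kerr of label `(M₁, a₁)` beyond `J⁻(K₁)` have `|a₁| ≤ χ₁ M₁` for some `χ₁ < 1`). Re-declared
here (a record, not a route item) only so that the negative-side theorems below keep elaborating
under their original statements; the live route item is `TameCensorshipCollarMargin`. -/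
def GenericCensorshipCollarMargin : Prop :=
  open Literature.Geometry.Lorentzian in ∀ (X : Type) [TopologicalSpace X] [ChartedSpace E3 X] [IsManifold (𝓡 3) ((⊤ : ℕ∞) : WithTop ℕ∞) X] [T2Space X] [SecondCountableTopology X] [ConnectedSpace X], InitialDataSet.IsChristodoulouGeneric (admissibleVacuumData X) (fun D => ∀ 𝒟 : VacuumCauchyDevelopment D, 𝒟.IsMaximal → Summit.FinalStateConjecture.HasCompleteNullInfinity 𝒟.toCauchyDevelopment ∧ (∃ (χ₁ : ℝ) (k₁ : ℕ) (δ₁ : ENNReal) (K₁ : Set 𝒟.carrier), χ₁ < 1 ∧ 0 < δ₁ ∧ IsCompact K₁ ∧ ∀ (M₁ a₁ : ℝ) (mo₁ : lorentzGroup × E4) (B₁ : ModelBackground) (Φ₁ : B₁.domain → 𝒟.carrier), 0 < M₁ → |a₁| ≤ M₁ → B₁ = starBackground mo₁.1 mo₁.2 M₁ a₁ (fun x => Kerr.radius a₁ (poincareInv mo₁.1 mo₁.2 x)) → ContMDiffOn 𝓘(ℝ, E4) (𝓡 4) ((⊤ : ℕ∞) : WithTop ℕ∞) Φ₁ {x |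 -1 < B₁.time x.1 ∧ B₁.time x.1 < 1 ∧ B₁.radius x.1 < 3 * M₁ + 1} → Topology.IsOpenEmbedding ({x | -1 < B₁.time x.1 ∧ B₁.time x.1 < 1 ∧ B₁.radius x.1 < 3 * M₁ + 1}.restrict Φ₁) → 𝒟.toSpacetime.truncDeviationCk B₁ Φ₁ k₁ (3 * M₁) 0 ≤ δ₁ → Disjoint (Φ₁ '' B₁.truncTimeSlab (3 * M₁) 0) (𝒟.metric.causalPast 𝒟.timeOrientation K₁) → |a₁| ≤ χ₁ * M₁)) 1

end Summit.FinalStateConjecture.FinalStateConjecture.Theses.BartnikGapSettling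

namespace Summit.FinalStateConjecture.FinalStateConjecture.Theorems.GenericCensorshipCollarMargin.Negative

open Literature.Geometry.Lorentzian
open Summit.FinalStateConjecture.FinalStateConjecture.Theses.BartnikGapSettling
  (GenericCensorshipCollarMargin MGHDExists)

/-- **Construction hypothesis `H` (extremal junk collars everywhere).** Every maximal vacuum
Cauchy development of every admissible datum carries, for every order `k₁`, every size
`0 < δ₁` and every compact `K₁`, a thick collar chart `Φ₁` of EXTREMAL label `(M₁, a₁ = M₁)`,
`0 < M₁`, on the boosted Kerr star background, smooth on and an open embedding of the collar
layer `{−1 < t* < 1, r < 3M₁ + 1}`, `δ₁`-close in `C^{k₁}` to boosted Kerr on the thick collar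
slab (`truncDeviationCk … k₁ (3M₁) 0 ≤ δ₁`) and with slab image disjoint from `J⁻(K₁)` — i.e. a
chart meeting every hypothesis of the collar-margin clause of items 10808/10809 verbatim with
`|a₁| = M₁`. Expected to hold (junk charts at labels `M₁ → ∞` in far-field near-flat regions, by
the Lorentzian one-sided Nash–Kuiper theorem, A. Boukholkhal, arXiv:2407.19333v2, Thm. 1.2 and
Prop. 3.1, plus degree-`0` homogeneity of Kerr–Schild and Cauchy stability in the asymptotically
flat end); NOT constructed in the tree. -/
def ExtremalJunkCollars : Prop :=
  ∀ (X : Type) [TopologicalSpace X] [ChartedSpace E3 X]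
    [IsManifold (𝓡 3) ((⊤ : ℕ∞) : WithTop ℕ∞) X] [T2Space X] [SecondCountableTopology X]
    [ConnectedSpace X],
    ∀ D ∈ admissibleVacuumData X, ∀ 𝒟 : VacuumCauchyDevelopment D, 𝒟.IsMaximal →
      ∀ (k₁ : ℕ) (δ₁ : ℝ≥0∞) (K₁ : Set 𝒟.carrier), 0 < δ₁ → IsCompact K₁ →
        ∃ (M₁ : ℝ) (mo₁ : lorentzGroup × E4) (B₁ : ModelBackground)
          (Φ₁ : B₁.domain → 𝒟.carrier),
          0 < M₁ ∧
          B₁ = starBackground mo₁.1 mo₁.2 M₁ M₁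
            (fun x => Kerr.radius M₁ (poincareInv mo₁.1 mo₁.2 x)) ∧
          ContMDiffOn 𝓘(ℝ, E4) (𝓡 4) ((⊤ : ℕ∞) : WithTop ℕ∞) Φ₁
            {x | -1 < B₁.time x.1 ∧ B₁.time x.1 < 1 ∧ B₁.radius x.1 < 3 * M₁ + 1} ∧
          Topology.IsOpenEmbedding
            ({x | -1 < B₁.time x.1 ∧ B₁.time x.1 < 1 ∧ B₁.radius x.1 < 3 * M₁ + 1}.restrict Φ₁) ∧
          𝒟.toSpacetime.truncDeviationCk B₁ Φ₁ k₁ (3 * M₁) 0 ≤ δ₁ ∧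
          Disjoint (Φ₁ '' B₁.truncTimeSlab (3 * M₁) 0)
            (𝒟.metric.causalPast 𝒟.timeOrientation K₁)

section Clause

variable {X : Type} [TopologicalSpace X] [ChartedSpace E3 X]
  [IsManifold (𝓡 3) ((⊤ : ℕ∞) : WithTop ℕ∞) X] [ConnectedSpace X] {D : InitialDataSet (𝓡 3) X}

/-- **A junk chart refutes the clause.** If a development `𝒟` carries, at EVERY tolerance
`(k₁, δ₁, K₁)`, a chart of extremal label `a₁ = M₁ > 0` meeting the hypotheses of the
collar-margin clause, then the clause (verbatim the second conjunct of item 10809's property / the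
hypothesis of item 10808) fails for `𝒟`: its conclusion would give `|M₁| ≤ χ₁ M₁ < M₁`.
[folklore] -/
theorem not_collarMarginClause_of_junk (𝒟 : VacuumCauchyDevelopment D)
    (hJ : ∀ (k₁ : ℕ) (δ₁ : ℝ≥0∞) (K₁ : Set 𝒟.carrier), 0 < δ₁ → IsCompact K₁ →
        ∃ (M₁ : ℝ) (mo₁ : lorentzGroup × E4) (B₁ : ModelBackground)
          (Φ₁ : B₁.domain → 𝒟.carrier),
          0 < M₁ ∧
          B₁ = starBackground mo₁.1 mo₁.2 M₁ M₁
            (fun x => Kerr.radius M₁ (poincareInv mo₁.1 mo₁.2 x)) ∧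
          ContMDiffOn 𝓘(ℝ, E4) (𝓡 4) ((⊤ : ℕ∞) : WithTop ℕ∞) Φ₁
            {x | -1 < B₁.time x.1 ∧ B₁.time x.1 < 1 ∧ B₁.radius x.1 < 3 * M₁ + 1} ∧
          Topology.IsOpenEmbedding
            ({x | -1 < B₁.time x.1 ∧ B₁.time x.1 < 1 ∧ B₁.radius x.1 < 3 * M₁ + 1}.restrict Φ₁) ∧
          𝒟.toSpacetime.truncDeviationCk B₁ Φ₁ k₁ (3 * M₁) 0 ≤ δ₁ ∧
          Disjoint (Φ₁ '' B₁.truncTimeSlab (3 * M₁) 0)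
            (𝒟.metric.causalPast 𝒟.timeOrientation K₁)) :
    ¬ (∃ (χ₁ : ℝ) (k₁ : ℕ) (δ₁ : ℝ≥0∞) (K₁ : Set 𝒟.carrier), χ₁ < 1 ∧ 0 < δ₁ ∧ IsCompact K₁ ∧
        ∀ (M₁ a₁ : ℝ) (mo₁ : lorentzGroup × E4) (B₁ : ModelBackground)
          (Φ₁ : B₁.domain → 𝒟.carrier), 0 < M₁ → |a₁| ≤ M₁ →
          B₁ = starBackground mo₁.1 mo₁.2 M₁ a₁
            (fun x => Kerr.radius a₁ (poincareInv mo₁.1 mo₁.2 x)) →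
          ContMDiffOn 𝓘(ℝ, E4) (𝓡 4) ((⊤ : ℕ∞) : WithTop ℕ∞) Φ₁
            {x | -1 < B₁.time x.1 ∧ B₁.time x.1 < 1 ∧ B₁.radius x.1 < 3 * M₁ + 1} →
          Topology.IsOpenEmbedding
            ({x | -1 < B₁.time x.1 ∧ B₁.time x.1 < 1 ∧ B₁.radius x.1 < 3 * M₁ + 1}.restrict Φ₁) →
          𝒟.toSpacetime.truncDeviationCk B₁ Φ₁ k₁ (3 * M₁) 0 ≤ δ₁ →
          Disjoint (Φ₁ '' B₁.truncTimeSlab (3 * M₁) 0)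
            (𝒟.metric.causalPast 𝒟.timeOrientation K₁) →
          |a₁| ≤ χ₁ * M₁) := by
  rintro ⟨χ₁, k₁, δ₁, K₁, hχ₁, hδ₁, hK₁, hm⟩
  obtain ⟨M₁, mo₁, B₁, Φ₁, hM₁, hB, hsm, hemb, hdev, hdisj⟩ := hJ k₁ δ₁ K₁ hδ₁ hK₁
  have h₁ : |M₁| ≤ χ₁ * M₁ :=
    hm M₁ M₁ mo₁ B₁ Φ₁ hM₁ (abs_of_pos hM₁).le hB hsm hemb hdev hdisj
  rw [abs_of_pos hM₁] at h₁
  nlinarith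

end Clause

/-- **The crux as typed is false modulo junk collars and MGHD existence.** Under
`ExtremalJunkCollars` and the route's support item `MGHDExists` (Choquet-Bruhat–Geroch), the
property of item 10809 — every MGHD has complete `𝓘⁺` AND the collar margin — fails for EVERY
admissible datum (take the MGHD, then `not_collarMarginClause_of_junk`); the admissible class of the
Minkowski slice `Minkowski.slice ≅ ℝ³` is non-empty (`trivialData_mem_admissibleVacuumData`), and a
Christodoulou-generic property must hold at the parameter-`c ≠ 0` members of an admissible family
through the trivial datum — contradiction. So `GenericCensorshipCollarMargin` is false as typed,
independently of weak cosmic censorship and of any third law (verdict MISSTATED; repair: window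
the label `m₀ ≤ M₁ ≤ m₀⁻¹`). [folklore] -/
theorem GenericCensorshipCollarMargin_false_of_ExtremalJunkCollars :
    ExtremalJunkCollars → MGHDExists → ¬ GenericCensorshipCollarMargin := by
  intro hJ hE hG
  -- the property of the crux fails for every admissible datum of the Minkowski slice
  have hP : ∀ D ∈ admissibleVacuumData Minkowski.slice,
      ¬ (∀ 𝒟 : VacuumCauchyDevelopment D, 𝒟.IsMaximal →
        Summit.FinalStateConjecture.HasCompleteNullInfinity 𝒟.toCauchyDevelopment ∧
        (∃ (χ₁ : ℝ) (k₁ : ℕ) (δ₁ : ℝ≥0∞) (K₁ : Set 𝒟.carrier), χ₁ < 1 ∧ 0 < δ₁ ∧ IsCompact K₁ ∧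
          ∀ (M₁ a₁ : ℝ) (mo₁ : lorentzGroup × E4) (B₁ : ModelBackground)
            (Φ₁ : B₁.domain → 𝒟.carrier), 0 < M₁ → |a₁| ≤ M₁ →
            B₁ = starBackground mo₁.1 mo₁.2 M₁ a₁
              (fun x => Kerr.radius a₁ (poincareInv mo₁.1 mo₁.2 x)) →
            ContMDiffOn 𝓘(ℝ, E4) (𝓡 4) ((⊤ : ℕ∞) : WithTop ℕ∞) Φ₁
              {x | -1 < B₁.time x.1 ∧ B₁.time x.1 < 1 ∧ B₁.radius x.1 < 3 * M₁ + 1} →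
            Topology.IsOpenEmbedding
              ({x | -1 < B₁.time x.1 ∧ B₁.time x.1 < 1 ∧
                  B₁.radius x.1 < 3 * M₁ + 1}.restrict Φ₁) →
            𝒟.toSpacetime.truncDeviationCk B₁ Φ₁ k₁ (3 * M₁) 0 ≤ δ₁ →
            Disjoint (Φ₁ '' B₁.truncTimeSlab (3 * M₁) 0)
              (𝒟.metric.causalPast 𝒟.timeOrientation K₁) →
            |a₁| ≤ χ₁ * M₁)) := by
    intro D hD hPD
    obtain ⟨𝒟, hmax⟩ := hE Minkowski.slice D hD
    exact not_collarMarginClause_of_junk 𝒟 (hJ Minkowski.slice D hD 𝒟 hmax) (hPD 𝒟 hmax).2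
  -- the trivial datum is admissible and exceptional; a generic property needs an escaping family
  obtain ⟨F, -, -, -, hF𝓓, hFE⟩ :=
    hG Minkowski.slice trivialData
      ⟨trivialData_mem_admissibleVacuumData, hP trivialData trivialData_mem_admissibleVacuumData⟩
  obtain ⟨c, hc⟩ := exists_ne (0 : EuclideanSpace ℝ (Fin 1))
  exact hFE c hc ⟨hF𝓓 c, hP (F c) (hF𝓓 c)⟩

end Summit.FinalStateConjecture.FinalStateConjecture.Theorems.GenericCensorshipCollarMargin.Negative

end
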